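import Literature.NumberTheory.Rogawski1990.ArchInnerTransferReadInner         -- ★ (11) READ-INNER part 3 (this seat): `isArchInnerTransfer_of_stableSumG_eq`
import Literature.NumberTheory.Rogawski1990.ArchCompatibleFamiliesGExist       -- ★ (∃G) `exists_archCompatibleFamiliesG`
import Literature.NumberTheory.Rogawski1990.ArchInnerTransferCompatible        -- ★ the letter: `IsArchInnerTransfer(Exists)`
import Literature.NumberTheory.Rogawski1990.ArchSmoothCongruence               -- ★ (T-d) `ArchSmooth.comp_archCongr`
import HarnessLib

/-!
# The junction of the archimedean inner-form transfer (N8-INNER brick (11)): one compatible system with the `C_c^∞` transfer, from the stable surjection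

Topic `NumberTheory/Rogawski1990`; namespace `Literature.NumberTheory.Rogawski1990`.  THEOREMS ONLY (no `def`, no instance, no notation,
no axiom, no named fact, no `sorry`).

For a CM field `L`, a diagonal anisotropic hermitian frame `H′ = diagonal α` (`G′_∞ = U(H′)(L ⊗ ℝ)`), the quasi-split inner form
`G_∞ = U(Φ₃)(L ⊗ ℝ)` (`Φ₃` the antidiagonal unit form) and Haar measures `ν′`, `ν`, this file assembles PRINT'S ONE-SYSTEM SENTENCE
«If `v ∈ S₀`, the existence of `f_v` follows from results of Shelstad» [Rogawski1990, §14.2 p. 233]: there is a compatible Weil-form system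
`(m′, m, t′, t)` (★ `ArchCompatibleFamiliesG`, print's measure convention §1.7 p. 6, [Shelstad1979, §4 p. 20]) for which every
`a′ ∈ C_c^∞(G′_∞)` has an `f ∈ C_c^∞(G_∞)` with matching stable orbital integrals (14.2.1) (★ `IsArchInnerTransferExists`), FROM ONE INPUT:
the STABLE SURJECTION on the quasi-split atlas (hypothesis `hSurj`, the Euler–Poincaré assembly of the road): for every `a′` an
`f ∈ C_c^∞(U(diag β₀)(L ⊗ ℝ))`, `β₀ = (½, 1, −½)`, whose stable chart sums `stableSumG (orbFamGExt L β₀ (ν.map Φ) f)` equal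
`stableSumG (κ • orbFamGExt L α ν′ a′)` on the regular set of every chart, `κ = 3^{−#{definite places of α}}`.

* §1 LAYER 1 (pure logic): `isArchInnerTransferExists_of_surj_of_read`, `exists_archCompatibleFamiliesG_and_isArchInnerTransferExists_of_surj_of_read` —
  surjection + READ-INNER + `C_c^∞` transport along the congruence ⇒ the sentence, for the system of ★ `exists_archCompatibleFamiliesG`.
* §2 THE JUNCTION at an ambient congruence `Φ : U(Φ₃)_∞ ≃ₜ* U(diag β₀)_∞`, `Φ g = T g T⁻¹`:
  `exists_archCompatibleFamiliesG_and_isArchInnerTransferExists_of_stableSurjG` — READ-INNER is ★ `isArchInnerTransfer_of_stableSumG_eq`, the transport is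
  ★ `ArchSmooth.comp_archCongr`; the ONLY hypothesis left is `hSurj`.
* §3 `isMulRightInvariant_map_archCongr` — right invariance of `ν.map Φ` (the one instance hypothesis of §2 Mathlib does not synthesise; the Haar
  property is Mathlib's instance `ContinuousMulEquiv.isHaarMeasure_map`).  Consumers instantiate §2 at the quasi-split congruence `Ψ_Q`
  (`Q = [[1,0,1],[0,1,0],[1,0,−1]]`, ★ `formCongr_quasiSplitFrame_diagonal`, `hΦ :=` ★ `coe_archCongrOfEq_quasiSplit_apply L`) inside their proof.

HONEST LABEL.  Nothing here asserts the stable surjection; HC_CM is proved only modulo the printed citations until rung 0 closes.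

## References
* [Rogawski1990] J. D. Rogawski, *Automorphic Representations of Unitary Groups in Three Variables*, Ann. of Math. Stud. 123 (1990), §1.7 p. 6,
  §4.3 (4.3.1) pp. 43–44, §14.1 p. 232, §14.2 (14.2.1) pp. 232–233.
* [Shelstad1979] D. Shelstad, *Characters and inner forms of a quasi-split group over ℝ*, Compositio Math. 39 (1979) 11–45, §4 p. 20, Thm. 4.1 p. 21.
-/

set_option autoImplicit false

noncomputable section

open MeasureTheory MeasureTheory.Measure NumberField NumberField.InfinitePlace Matrix Complex Topology Finset
open Literature.MeasureTheory.Group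
open scoped MatrixGroups Matrix Classical NNReal ENNReal

namespace Literature.NumberTheory.Rogawski1990

open Literature.NumberTheory.Automorphic Literature.NumberTheory.Automorphic.UnitaryGroup Literature.NumberTheory.Automorphic.ArchCartan

/-! ## §1 Layer 1: the logic of the payer -/

section Layer1

variable (L : Type) [Field L] [NumberField L] [IsCMField L] (α : Fin 3 → L)
  [MeasurableSpace ↥(arch (↥(maximalRealSubfield L)) L (IsCMField.complexConj L) 3 (Matrix.diagonal α))]
  [BorelSpace ↥(arch (↥(maximalRealSubfield L)) L (IsCMField.complexConj L) 3 (Matrix.diagonal α))]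
  [MeasurableSpace ↥(arch (↥(maximalRealSubfield L)) L (IsCMField.complexConj L) 3 (Matrix.diagonal ![(2 : L)⁻¹, 1, -(2 : L)⁻¹]))]
  [BorelSpace ↥(arch (↥(maximalRealSubfield L)) L (IsCMField.complexConj L) 3 (Matrix.diagonal ![(2 : L)⁻¹, 1, -(2 : L)⁻¹]))]
  (ν' : Measure ↥(arch (↥(maximalRealSubfield L)) L (IsCMField.complexConj L) 3 (Matrix.diagonal α)))
  (νβ : Measure ↥(arch (↥(maximalRealSubfield L)) L (IsCMField.complexConj L) 3 (Matrix.diagonal ![(2 : L)⁻¹, 1, -(2 : L)⁻¹])))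
  [ν'.IsHaarMeasure] [ν'.IsMulRightInvariant] [νβ.IsHaarMeasure] [νβ.IsMulRightInvariant]
  (Φ : ↥(arch (↥(maximalRealSubfield L)) L (IsCMField.complexConj L) 3
      (Matrix.of fun i j : Fin 3 => if i.val + j.val + 1 = 3 then (1 : L) else 0)) ≃ₜ*
        ↥(arch (↥(maximalRealSubfield L)) L (IsCMField.complexConj L) 3 (Matrix.diagonal ![(2 : L)⁻¹, 1, -(2 : L)⁻¹])))
  (κ : ℂ)

/-- **LAYER 1a — pointwise in the system.**  The stable surjection on the quasi-split atlas + READ-INNER + the `C_c^∞` transport along the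
congruence ⇒ the (14.2.1) `C_c^∞` inner transfer for the given families `(m′, m)`.  Pure logic.
[cite: Rogawski1990, §14.2 (14.2.1) pp. 232–233] [cite: Shelstad1979, §4 Thm. 4.1 (p. 21)] -/
theorem isArchInnerTransferExists_of_surj_of_read
    {_hγ' : ∀ γ : ↥(arch (↥(maximalRealSubfield L)) L (IsCMField.complexConj L) 3 (Matrix.diagonal α)),
      MeasurableSpace (↥(arch (↥(maximalRealSubfield L)) L (IsCMField.complexConj L) 3 (Matrix.diagonal α)) ⧸
        Subgroup.centralizer ({γ} : Set ↥(arch (↥(maximalRealSubfield L)) L (IsCMField.complexConj L) 3 (Matrix.diagonal α))))}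
    {_hγ : ∀ γ : ↥(arch (↥(maximalRealSubfield L)) L (IsCMField.complexConj L) 3
        (Matrix.of fun i j : Fin 3 => if i.val + j.val + 1 = 3 then (1 : L) else 0)),
      MeasurableSpace (↥(arch (↥(maximalRealSubfield L)) L (IsCMField.complexConj L) 3
          (Matrix.of fun i j : Fin 3 => if i.val + j.val + 1 = 3 then (1 : L) else 0)) ⧸
        Subgroup.centralizer ({γ} : Set ↥(arch (↥(maximalRealSubfield L)) L (IsCMField.complexConj L) 3
          (Matrix.of fun i j : Fin 3 => if i.val + j.val + 1 = 3 then (1 : L) else 0))))}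
    (m' : OrbitalMeasureFamily ↥(arch (↥(maximalRealSubfield L)) L (IsCMField.complexConj L) 3 (Matrix.diagonal α)))
    (m : OrbitalMeasureFamily ↥(arch (↥(maximalRealSubfield L)) L (IsCMField.complexConj L) 3
      (Matrix.of fun i j : Fin 3 => if i.val + j.val + 1 = 3 then (1 : L) else 0)))
    (hSurj : ∀ a' : ↥(arch (↥(maximalRealSubfield L)) L (IsCMField.complexConj L) 3 (Matrix.diagonal α)) → ℂ,
      ArchSmooth L 3 (Matrix.diagonal α) a' →
        ∃ f : ↥(arch (↥(maximalRealSubfield L)) L (IsCMField.complexConj L) 3 (Matrix.diagonal ![(2 : L)⁻¹, 1, -(2 : L)⁻¹])) → ℂ,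
          ArchSmooth L 3 (Matrix.diagonal ![(2 : L)⁻¹, 1, -(2 : L)⁻¹]) f ∧
            ∀ (S : Finset {w : InfinitePlace L // IsComplex w}) (c : {w : InfinitePlace L // IsComplex w} → Fin 3 → ℝ),
              c ∈ RegG S →
                stableSumG (orbFamGExt L ![(2 : L)⁻¹, 1, -(2 : L)⁻¹] νβ f) S c =
                  stableSumG (fun S' c' => κ * orbFamGExt L α ν' a' S' c') S c)
    (hSmoothΦ : ∀ f : ↥(arch (↥(maximalRealSubfield L)) L (IsCMField.complexConj L) 3 (Matrix.diagonal ![(2 : L)⁻¹, 1, -(2 : L)⁻¹])) → ℂ,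
      ArchSmooth L 3 (Matrix.diagonal ![(2 : L)⁻¹, 1, -(2 : L)⁻¹]) f →
        ArchSmooth L 3 (Matrix.of fun i j : Fin 3 => if i.val + j.val + 1 = 3 then (1 : L) else 0) (f ∘ Φ))
    (hRead : ∀ (a' : ↥(arch (↥(maximalRealSubfield L)) L (IsCMField.complexConj L) 3 (Matrix.diagonal α)) → ℂ)
        (f : ↥(arch (↥(maximalRealSubfield L)) L (IsCMField.complexConj L) 3 (Matrix.diagonal ![(2 : L)⁻¹, 1, -(2 : L)⁻¹])) → ℂ),
      ArchSmooth L 3 (Matrix.diagonal α) a' → ArchSmooth L 3 (Matrix.diagonal ![(2 : L)⁻¹, 1, -(2 : L)⁻¹]) f →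
        (∀ (S : Finset {w : InfinitePlace L // IsComplex w}) (c : {w : InfinitePlace L // IsComplex w} → Fin 3 → ℝ),
            c ∈ RegG S →
              stableSumG (orbFamGExt L ![(2 : L)⁻¹, 1, -(2 : L)⁻¹] νβ f) S c =
                stableSumG (fun S' c' => κ * orbFamGExt L α ν' a' S' c') S c) →
          IsArchInnerTransfer L (Matrix.diagonal α) m' m a' (f ∘ Φ)) :
    IsArchInnerTransferExists L (Matrix.diagonal α) m' m (ArchSmooth L 3 (Matrix.diagonal α))
      (ArchSmooth L 3 (Matrix.of fun i j : Fin 3 => if i.val + j.val + 1 = 3 then (1 : L) else 0)) := by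
  intro a' ha'
  obtain ⟨f, hf, hEq⟩ := hSurj a' ha'
  exact ⟨f ∘ Φ, hSmoothΦ f hf, hRead a' f ha' hf hEq⟩

variable
  [MeasurableSpace ↥(arch (↥(maximalRealSubfield L)) L (IsCMField.complexConj L) 3
      (Matrix.of fun i j : Fin 3 => if i.val + j.val + 1 = 3 then (1 : L) else 0))]
  [BorelSpace ↥(arch (↥(maximalRealSubfield L)) L (IsCMField.complexConj L) 3
      (Matrix.of fun i j : Fin 3 => if i.val + j.val + 1 = 3 then (1 : L) else 0))]
  (ν : Measure ↥(arch (↥(maximalRealSubfield L)) L (IsCMField.complexConj L) 3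
      (Matrix.of fun i j : Fin 3 => if i.val + j.val + 1 = 3 then (1 : L) else 0)))
  [ν.IsHaarMeasure] [ν.IsMulRightInvariant]

/-- **LAYER 1b — THE PAYER'S SHAPE** (the body of the one-system sentence at `H′ = diagonal α`, Borel σ-algebras on the orbit quotients):
the system is ★ (∃G) `exists_archCompatibleFamiliesG`; READ-INNER is asked for every compatible system.  Pure logic.
[cite: Rogawski1990, §14.2 (14.2.1) pp. 232–233; §1.7 p. 6] [cite: Shelstad1979, §4 p. 20, Thm. 4.1 (p. 21)] -/
theorem exists_archCompatibleFamiliesG_and_isArchInnerTransferExists_of_surj_of_read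
    (hanis : ∀ x : Fin 3 → L, Literature.AlgebraicGeometry.ShimuraVarieties.hermForm (cmConjRingHom L) (Matrix.diagonal α) x x = 0 → x = 0)
    (hSurj : ∀ a' : ↥(arch (↥(maximalRealSubfield L)) L (IsCMField.complexConj L) 3 (Matrix.diagonal α)) → ℂ,
      ArchSmooth L 3 (Matrix.diagonal α) a' →
        ∃ f : ↥(arch (↥(maximalRealSubfield L)) L (IsCMField.complexConj L) 3 (Matrix.diagonal ![(2 : L)⁻¹, 1, -(2 : L)⁻¹])) → ℂ,
          ArchSmooth L 3 (Matrix.diagonal ![(2 : L)⁻¹, 1, -(2 : L)⁻¹]) f ∧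
            ∀ (S : Finset {w : InfinitePlace L // IsComplex w}) (c : {w : InfinitePlace L // IsComplex w} → Fin 3 → ℝ),
              c ∈ RegG S →
                stableSumG (orbFamGExt L ![(2 : L)⁻¹, 1, -(2 : L)⁻¹] νβ f) S c =
                  stableSumG (fun S' c' => κ * orbFamGExt L α ν' a' S' c') S c)
    (hSmoothΦ : ∀ f : ↥(arch (↥(maximalRealSubfield L)) L (IsCMField.complexConj L) 3 (Matrix.diagonal ![(2 : L)⁻¹, 1, -(2 : L)⁻¹])) → ℂ,
      ArchSmooth L 3 (Matrix.diagonal ![(2 : L)⁻¹, 1, -(2 : L)⁻¹]) f →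
        ArchSmooth L 3 (Matrix.of fun i j : Fin 3 => if i.val + j.val + 1 = 3 then (1 : L) else 0) (f ∘ Φ))
    (hRead :
      letI : ∀ γ : ↥(arch (↥(maximalRealSubfield L)) L (IsCMField.complexConj L) 3 (Matrix.diagonal α)),
          MeasurableSpace (↥(arch (↥(maximalRealSubfield L)) L (IsCMField.complexConj L) 3 (Matrix.diagonal α)) ⧸
            Subgroup.centralizer ({γ} : Set ↥(arch (↥(maximalRealSubfield L)) L (IsCMField.complexConj L) 3 (Matrix.diagonal α)))) :=
        fun _ => borel _
      letI : ∀ γ : ↥(arch (↥(maximalRealSubfield L)) L (IsCMField.complexConj L) 3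
            (Matrix.of fun i j : Fin 3 => if i.val + j.val + 1 = 3 then (1 : L) else 0)),
          MeasurableSpace (↥(arch (↥(maximalRealSubfield L)) L (IsCMField.complexConj L) 3
              (Matrix.of fun i j : Fin 3 => if i.val + j.val + 1 = 3 then (1 : L) else 0)) ⧸
            Subgroup.centralizer ({γ} : Set ↥(arch (↥(maximalRealSubfield L)) L (IsCMField.complexConj L) 3
              (Matrix.of fun i j : Fin 3 => if i.val + j.val + 1 = 3 then (1 : L) else 0)))) :=
        fun _ => borel _
      ∀ (m' : OrbitalMeasureFamily ↥(arch (↥(maximalRealSubfield L)) L (IsCMField.complexConj L) 3 (Matrix.diagonal α)))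
        (m : OrbitalMeasureFamily ↥(arch (↥(maximalRealSubfield L)) L (IsCMField.complexConj L) 3
          (Matrix.of fun i j : Fin 3 => if i.val + j.val + 1 = 3 then (1 : L) else 0)))
        (t' : ∀ γ' : ↥(arch (↥(maximalRealSubfield L)) L (IsCMField.complexConj L) 3 (Matrix.diagonal α)),
          Measure (Subgroup.centralizer ({γ'} : Set ↥(arch (↥(maximalRealSubfield L)) L (IsCMField.complexConj L) 3 (Matrix.diagonal α)))))
        (t : ∀ γ : ↥(arch (↥(maximalRealSubfield L)) L (IsCMField.complexConj L) 3
            (Matrix.of fun i j : Fin 3 => if i.val + j.val + 1 = 3 then (1 : L) else 0)),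
          Measure (Subgroup.centralizer ({γ} : Set ↥(arch (↥(maximalRealSubfield L)) L (IsCMField.complexConj L) 3
            (Matrix.of fun i j : Fin 3 => if i.val + j.val + 1 = 3 then (1 : L) else 0))))),
        ArchCompatibleFamiliesG L (Matrix.diagonal α) ν' ν hanis m' m t' t →
          ∀ (a' : ↥(arch (↥(maximalRealSubfield L)) L (IsCMField.complexConj L) 3 (Matrix.diagonal α)) → ℂ)
            (f : ↥(arch (↥(maximalRealSubfield L)) L (IsCMField.complexConj L) 3 (Matrix.diagonal ![(2 : L)⁻¹, 1, -(2 : L)⁻¹])) → ℂ),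
            ArchSmooth L 3 (Matrix.diagonal α) a' → ArchSmooth L 3 (Matrix.diagonal ![(2 : L)⁻¹, 1, -(2 : L)⁻¹]) f →
              (∀ (S : Finset {w : InfinitePlace L // IsComplex w}) (c : {w : InfinitePlace L // IsComplex w} → Fin 3 → ℝ),
                  c ∈ RegG S →
                    stableSumG (orbFamGExt L ![(2 : L)⁻¹, 1, -(2 : L)⁻¹] νβ f) S c =
                      stableSumG (fun S' c' => κ * orbFamGExt L α ν' a' S' c') S c) →
                IsArchInnerTransfer L (Matrix.diagonal α) m' m a' (f ∘ Φ)) :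
    letI : ∀ γ : ↥(arch (↥(maximalRealSubfield L)) L (IsCMField.complexConj L) 3 (Matrix.diagonal α)),
        MeasurableSpace (↥(arch (↥(maximalRealSubfield L)) L (IsCMField.complexConj L) 3 (Matrix.diagonal α)) ⧸
          Subgroup.centralizer ({γ} : Set ↥(arch (↥(maximalRealSubfield L)) L (IsCMField.complexConj L) 3 (Matrix.diagonal α)))) :=
      fun _ => borel _
    haveI : ∀ γ : ↥(arch (↥(maximalRealSubfield L)) L (IsCMField.complexConj L) 3 (Matrix.diagonal α)),
        BorelSpace (↥(arch (↥(maximalRealSubfield L)) L (IsCMField.complexConj L) 3 (Matrix.diagonal α)) ⧸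
          Subgroup.centralizer ({γ} : Set ↥(arch (↥(maximalRealSubfield L)) L (IsCMField.complexConj L) 3 (Matrix.diagonal α)))) :=
      fun _ => ⟨rfl⟩
    letI : ∀ γ : ↥(arch (↥(maximalRealSubfield L)) L (IsCMField.complexConj L) 3
          (Matrix.of fun i j : Fin 3 => if i.val + j.val + 1 = 3 then (1 : L) else 0)),
        MeasurableSpace (↥(arch (↥(maximalRealSubfield L)) L (IsCMField.complexConj L) 3
            (Matrix.of fun i j : Fin 3 => if i.val + j.val + 1 = 3 then (1 : L) else 0)) ⧸
          Subgroup.centralizer ({γ} : Set ↥(arch (↥(maximalRealSubfield L)) L (IsCMField.complexConj L) 3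
            (Matrix.of fun i j : Fin 3 => if i.val + j.val + 1 = 3 then (1 : L) else 0)))) :=
      fun _ => borel _
    haveI : ∀ γ : ↥(arch (↥(maximalRealSubfield L)) L (IsCMField.complexConj L) 3
          (Matrix.of fun i j : Fin 3 => if i.val + j.val + 1 = 3 then (1 : L) else 0)),
        BorelSpace (↥(arch (↥(maximalRealSubfield L)) L (IsCMField.complexConj L) 3
            (Matrix.of fun i j : Fin 3 => if i.val + j.val + 1 = 3 then (1 : L) else 0)) ⧸
          Subgroup.centralizer ({γ} : Set ↥(arch (↥(maximalRealSubfield L)) L (IsCMField.complexConj L) 3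
            (Matrix.of fun i j : Fin 3 => if i.val + j.val + 1 = 3 then (1 : L) else 0)))) :=
      fun _ => ⟨rfl⟩
    ∃ (m' : OrbitalMeasureFamily ↥(arch (↥(maximalRealSubfield L)) L (IsCMField.complexConj L) 3 (Matrix.diagonal α)))
      (m : OrbitalMeasureFamily ↥(arch (↥(maximalRealSubfield L)) L (IsCMField.complexConj L) 3
        (Matrix.of fun i j : Fin 3 => if i.val + j.val + 1 = 3 then (1 : L) else 0)))
      (t' : ∀ γ' : ↥(arch (↥(maximalRealSubfield L)) L (IsCMField.complexConj L) 3 (Matrix.diagonal α)),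
        Measure (Subgroup.centralizer ({γ'} : Set ↥(arch (↥(maximalRealSubfield L)) L (IsCMField.complexConj L) 3 (Matrix.diagonal α)))))
      (t : ∀ γ : ↥(arch (↥(maximalRealSubfield L)) L (IsCMField.complexConj L) 3
          (Matrix.of fun i j : Fin 3 => if i.val + j.val + 1 = 3 then (1 : L) else 0)),
        Measure (Subgroup.centralizer ({γ} : Set ↥(arch (↥(maximalRealSubfield L)) L (IsCMField.complexConj L) 3
          (Matrix.of fun i j : Fin 3 => if i.val + j.val + 1 = 3 then (1 : L) else 0))))),
      ArchCompatibleFamiliesG L (Matrix.diagonal α) ν' ν hanis m' m t' t ∧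
        IsArchInnerTransferExists L (Matrix.diagonal α) m' m (ArchSmooth L 3 (Matrix.diagonal α))
          (ArchSmooth L 3 (Matrix.of fun i j : Fin 3 => if i.val + j.val + 1 = 3 then (1 : L) else 0)) := by
  obtain ⟨m', m, t', t, hS⟩ := exists_archCompatibleFamiliesG L (Matrix.diagonal α) ν' ν hanis
  exact ⟨m', m, t', t, hS,
    isArchInnerTransferExists_of_surj_of_read L α ν' νβ Φ κ m' m hSurj hSmoothΦ (hRead m' m t' t hS)⟩

end Layer1

/-! ## §2 The junction at an ambient congruence `Φ` -/

section Junction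

variable (L : Type) [Field L] [NumberField L] [IsCMField L] (α : Fin 3 → L)
  [MeasurableSpace ↥(arch (↥(maximalRealSubfield L)) L (IsCMField.complexConj L) 3 (Matrix.diagonal α))]
  [BorelSpace ↥(arch (↥(maximalRealSubfield L)) L (IsCMField.complexConj L) 3 (Matrix.diagonal α))]
  [MeasurableSpace ↥(arch (↥(maximalRealSubfield L)) L (IsCMField.complexConj L) 3
      (Matrix.of fun i j : Fin 3 => if i.val + j.val + 1 = 3 then (1 : L) else 0))]
  [BorelSpace ↥(arch (↥(maximalRealSubfield L)) L (IsCMField.complexConj L) 3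
      (Matrix.of fun i j : Fin 3 => if i.val + j.val + 1 = 3 then (1 : L) else 0))]
  [MeasurableSpace ↥(arch (↥(maximalRealSubfield L)) L (IsCMField.complexConj L) 3 (Matrix.diagonal ![(2 : L)⁻¹, 1, -(2 : L)⁻¹]))]
  [BorelSpace ↥(arch (↥(maximalRealSubfield L)) L (IsCMField.complexConj L) 3 (Matrix.diagonal ![(2 : L)⁻¹, 1, -(2 : L)⁻¹]))]
  (ν' : Measure ↥(arch (↥(maximalRealSubfield L)) L (IsCMField.complexConj L) 3 (Matrix.diagonal α)))
  (ν : Measure ↥(arch (↥(maximalRealSubfield L)) L (IsCMField.complexConj L) 3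
      (Matrix.of fun i j : Fin 3 => if i.val + j.val + 1 = 3 then (1 : L) else 0)))
  [ν'.IsHaarMeasure] [ν'.IsMulRightInvariant] [ν.IsHaarMeasure] [ν.IsMulRightInvariant]

/-- **THE JUNCTION (N8-INNER brick (11)) at an ambient congruence.**  For `Φ : U(Φ₃)_∞ ≃ₜ* U(diag β₀)_∞`, `Φ g = T g T⁻¹`, and the Haar
measure `ν.map Φ` on the quasi-split atlas group: the STABLE SURJECTION `hSurj` (for every `a′ ∈ C_c^∞(G′_∞)` an `f ∈ C_c^∞(U(diag β₀)_∞)` with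
`stableSumG (orbFamGExt L β₀ (ν.map Φ) f) = stableSumG (κ • orbFamGExt L α ν′ a′)` on the regular set of EVERY chart, `κ = ∏_{w definite for α} 3⁻¹`)
gives print's one-system sentence at `(diagonal α, Φ₃, ν′, ν)`: a compatible Weil-form system (★ `exists_archCompatibleFamiliesG`) with the `C_c^∞`
inner transfer (14.2.1) — READ-INNER is ★ `isArchInnerTransfer_of_stableSumG_eq`, the transport of `C_c^∞` along `Φ` is ★ `ArchSmooth.comp_archCongr`.
[cite: Rogawski1990, §14.2 (14.2.1) pp. 232–233; §1.7 p. 6; §4.3 (4.3.1) pp. 43–44] [cite: Shelstad1979, §4 p. 20, Thm. 4.1 (p. 21)] -/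
theorem exists_archCompatibleFamiliesG_and_isArchInnerTransferExists_of_stableSurjG
    (T : GL (Fin 3) (mixedEmbedding.mixedSpace L))
    (Φ : ↥(arch (↥(maximalRealSubfield L)) L (IsCMField.complexConj L) 3
        (Matrix.of fun i j : Fin 3 => if i.val + j.val + 1 = 3 then (1 : L) else 0)) ≃ₜ*
          ↥(arch (↥(maximalRealSubfield L)) L (IsCMField.complexConj L) 3 (Matrix.diagonal ![(2 : L)⁻¹, 1, -(2 : L)⁻¹])))
    (hΦ : ∀ g : ↥(arch (↥(maximalRealSubfield L)) L (IsCMField.complexConj L) 3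
        (Matrix.of fun i j : Fin 3 => if i.val + j.val + 1 = 3 then (1 : L) else 0)),
      ((Φ g : ↥(arch (↥(maximalRealSubfield L)) L (IsCMField.complexConj L) 3 (Matrix.diagonal ![(2 : L)⁻¹, 1, -(2 : L)⁻¹]))) :
          GL (Fin 3) (mixedEmbedding.mixedSpace L)) =
        T * (g : GL (Fin 3) (mixedEmbedding.mixedSpace L)) * T⁻¹)
    [(Measure.map Φ ν).IsHaarMeasure] [(Measure.map Φ ν).IsMulRightInvariant]
    (hα : ∀ i, α i ≠ 0) (hherm : ∀ i, (IsCMField.complexConj L (α i) : L) = α i)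
    (hanis : ∀ x : Fin 3 → L, Literature.AlgebraicGeometry.ShimuraVarieties.hermForm (cmConjRingHom L) (Matrix.diagonal α) x x = 0 → x = 0)
    (hSurj : ∀ a' : ↥(arch (↥(maximalRealSubfield L)) L (IsCMField.complexConj L) 3 (Matrix.diagonal α)) → ℂ,
      ArchSmooth L 3 (Matrix.diagonal α) a' →
        ∃ f : ↥(arch (↥(maximalRealSubfield L)) L (IsCMField.complexConj L) 3 (Matrix.diagonal ![(2 : L)⁻¹, 1, -(2 : L)⁻¹])) → ℂ,
          ArchSmooth L 3 (Matrix.diagonal ![(2 : L)⁻¹, 1, -(2 : L)⁻¹]) f ∧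
            ∀ (S : Finset {w : InfinitePlace L // IsComplex w}) (c : {w : InfinitePlace L // IsComplex w} → Fin 3 → ℝ),
              c ∈ RegG S →
                stableSumG (orbFamGExt L ![(2 : L)⁻¹, 1, -(2 : L)⁻¹] (Measure.map Φ ν) f) S c =
                  stableSumG (fun S' c' => (∏ _w ∈ Finset.univ.filter (fun w => ¬ IsIndefiniteAt (slotSign L α) w), (3 : ℂ)⁻¹) *
                    orbFamGExt L α ν' a' S' c') S c) :
    letI : ∀ γ : ↥(arch (↥(maximalRealSubfield L)) L (IsCMField.complexConj L) 3 (Matrix.diagonal α)),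
        MeasurableSpace (↥(arch (↥(maximalRealSubfield L)) L (IsCMField.complexConj L) 3 (Matrix.diagonal α)) ⧸
          Subgroup.centralizer ({γ} : Set ↥(arch (↥(maximalRealSubfield L)) L (IsCMField.complexConj L) 3 (Matrix.diagonal α)))) :=
      fun _ => borel _
    haveI : ∀ γ : ↥(arch (↥(maximalRealSubfield L)) L (IsCMField.complexConj L) 3 (Matrix.diagonal α)),
        BorelSpace (↥(arch (↥(maximalRealSubfield L)) L (IsCMField.complexConj L) 3 (Matrix.diagonal α)) ⧸
          Subgroup.centralizer ({γ} : Set ↥(arch (↥(maximalRealSubfield L)) L (IsCMField.complexConj L) 3 (Matrix.diagonal α)))) :=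
      fun _ => ⟨rfl⟩
    letI : ∀ γ : ↥(arch (↥(maximalRealSubfield L)) L (IsCMField.complexConj L) 3
          (Matrix.of fun i j : Fin 3 => if i.val + j.val + 1 = 3 then (1 : L) else 0)),
        MeasurableSpace (↥(arch (↥(maximalRealSubfield L)) L (IsCMField.complexConj L) 3
            (Matrix.of fun i j : Fin 3 => if i.val + j.val + 1 = 3 then (1 : L) else 0)) ⧸
          Subgroup.centralizer ({γ} : Set ↥(arch (↥(maximalRealSubfield L)) L (IsCMField.complexConj L) 3
            (Matrix.of fun i j : Fin 3 => if i.val + j.val + 1 = 3 then (1 : L) else 0)))) :=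
      fun _ => borel _
    haveI : ∀ γ : ↥(arch (↥(maximalRealSubfield L)) L (IsCMField.complexConj L) 3
          (Matrix.of fun i j : Fin 3 => if i.val + j.val + 1 = 3 then (1 : L) else 0)),
        BorelSpace (↥(arch (↥(maximalRealSubfield L)) L (IsCMField.complexConj L) 3
            (Matrix.of fun i j : Fin 3 => if i.val + j.val + 1 = 3 then (1 : L) else 0)) ⧸
          Subgroup.centralizer ({γ} : Set ↥(arch (↥(maximalRealSubfield L)) L (IsCMField.complexConj L) 3
            (Matrix.of fun i j : Fin 3 => if i.val + j.val + 1 = 3 then (1 : L) else 0)))) :=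
      fun _ => ⟨rfl⟩
    ∃ (m' : OrbitalMeasureFamily ↥(arch (↥(maximalRealSubfield L)) L (IsCMField.complexConj L) 3 (Matrix.diagonal α)))
      (m : OrbitalMeasureFamily ↥(arch (↥(maximalRealSubfield L)) L (IsCMField.complexConj L) 3
        (Matrix.of fun i j : Fin 3 => if i.val + j.val + 1 = 3 then (1 : L) else 0)))
      (t' : ∀ γ' : ↥(arch (↥(maximalRealSubfield L)) L (IsCMField.complexConj L) 3 (Matrix.diagonal α)),
        Measure (Subgroup.centralizer ({γ'} : Set ↥(arch (↥(maximalRealSubfield L)) L (IsCMField.complexConj L) 3 (Matrix.diagonal α)))))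
      (t : ∀ γ : ↥(arch (↥(maximalRealSubfield L)) L (IsCMField.complexConj L) 3
          (Matrix.of fun i j : Fin 3 => if i.val + j.val + 1 = 3 then (1 : L) else 0)),
        Measure (Subgroup.centralizer ({γ} : Set ↥(arch (↥(maximalRealSubfield L)) L (IsCMField.complexConj L) 3
          (Matrix.of fun i j : Fin 3 => if i.val + j.val + 1 = 3 then (1 : L) else 0))))),
      ArchCompatibleFamiliesG L (Matrix.diagonal α) ν' ν hanis m' m t' t ∧
        IsArchInnerTransferExists L (Matrix.diagonal α) m' m (ArchSmooth L 3 (Matrix.diagonal α))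
          (ArchSmooth L 3 (Matrix.of fun i j : Fin 3 => if i.val + j.val + 1 = 3 then (1 : L) else 0)) :=
  exists_archCompatibleFamiliesG_and_isArchInnerTransferExists_of_surj_of_read L α ν' (Measure.map Φ ν) Φ
    (∏ _w ∈ Finset.univ.filter (fun w => ¬ IsIndefiniteAt (slotSign L α) w), (3 : ℂ)⁻¹) ν hanis hSurj
    (fun _ hf => hf.comp_archCongr L T Φ hΦ)
    (isArchInnerTransfer_of_stableSumG_eq L α ν' ν T Φ hΦ hα hherm hanis)

/-! ## §3 The Haar frame on the quasi-split atlas group: right invariance of `ν.map Φ` -/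

omit [ν.IsHaarMeasure] in
/-- Right invariance of `ν` is carried to `ν.map Φ` by a topological group isomorphism `Φ : U(Φ₃)_∞ ≃ₜ* U(diag β₀)_∞` (Mathlib has the
Haar property as the instance `ContinuousMulEquiv.isHaarMeasure_map`; this is its right-invariant companion — the second instance hypothesis of
`exists_archCompatibleFamiliesG_and_isArchInnerTransferExists_of_stableSurjG`, e.g. at the quasi-split congruence `Ψ_Q` of ★
`coe_archCongrOfEq_quasiSplit_apply`). [cite: Rogawski1990, §1.7 p. 6; §14.1 p. 232] -/
theorem isMulRightInvariant_map_archCongr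
    (Φ : ↥(arch (↥(maximalRealSubfield L)) L (IsCMField.complexConj L) 3
        (Matrix.of fun i j : Fin 3 => if i.val + j.val + 1 = 3 then (1 : L) else 0)) ≃ₜ*
        ↥(arch (↥(maximalRealSubfield L)) L (IsCMField.complexConj L) 3 (Matrix.diagonal ![(2 : L)⁻¹, 1, -(2 : L)⁻¹]))) :
    (Measure.map Φ ν).IsMulRightInvariant := by
  refine ⟨fun h => ?_⟩
  have he : Measurable (Φ : ↥(arch (↥(maximalRealSubfield L)) L (IsCMField.complexConj L) 3
      (Matrix.of fun i j : Fin 3 => if i.val + j.val + 1 = 3 then (1 : L) else 0)) →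
      ↥(arch (↥(maximalRealSubfield L)) L (IsCMField.complexConj L) 3 (Matrix.diagonal ![(2 : L)⁻¹, 1, -(2 : L)⁻¹]))) := Φ.continuous.measurable
  obtain ⟨g, rfl⟩ := Φ.surjective h
  rw [Measure.map_map (measurable_mul_const _) he]
  conv_rhs => rw [← map_mul_right_eq_self ν g]
  rw [Measure.map_map he (measurable_mul_const _)]
  have hcomp : (fun x => x * Φ g) ∘ (Φ : ↥(arch (↥(maximalRealSubfield L)) L (IsCMField.complexConj L) 3
      (Matrix.of fun i j : Fin 3 => if i.val + j.val + 1 = 3 then (1 : L) else 0)) →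
      ↥(arch (↥(maximalRealSubfield L)) L (IsCMField.complexConj L) 3 (Matrix.diagonal ![(2 : L)⁻¹, 1, -(2 : L)⁻¹]))) = Φ ∘ fun x => x * g := by
    funext x
    simp only [Function.comp_apply, map_mul]
  rw [hcomp]

end Junction

end Literature.NumberTheory.Rogawski1990

end
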